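import Summits.BirchSwinnertonDyer.BirchSwinnertonDyer.Theorems.ByReductionTypeAtTwoSupersingularTowerTorsionTwo
import Summits.BirchSwinnertonDyer.Rank1Residual.X11b.AnticyclotomicStrictDescent
import Literature.NumberTheory.EllipticCurves.SelmerCorankAssembly
import Literature.NumberTheory.EllipticCurves.GreenbergSelmer
import HarnessLib

/-!
# Route `ThetaPartnerAtTwo` (TP2), crux K3 `SignedKatoDivisibilityUpToAtTwo` (item stmt-BirchSwinnertonDyer-20308),
# line `colemanrat` v7 — a brick for the (PT-orth) clause of the research stub (R2c): at `p = 2` the local restriction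
# `H¹(H ∩ D_v, E[2^∞]) → H¹(Gal(ℚ̄/ℚ_∞) ∩ D_v, E[2^∞])` is INJECTIVE for every `H ⊇ Gal(ℚ̄/ℚ_∞)` (every layer `Γ_n`)

Lead `bsd-wall-tp2-p2x` g4 (cell `bsd-wall`). HONEST FRAMING: THEOREMS ONLY (no definition, no named fact, no instance, no `sorry`);
closes no item; BSD is NOT proved by any of this.

Why. In the layer-`N` Poitou–Tate sum that proves (PT-orth) of `Cruxes.SignedKatoDivisibilityUpToAtTwo.ColemanRat.stub_layerSideTwoInv`, the
term at the prime above `2` is `inv_𝔭(x̄ ∪ loc_𝔭 t_N)` for a layer representative `t_N` of the Selmer class `t ∈ Sel⁺(E/ℚ_∞)`, while the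
stub's Kummer witness `(φ, Q, k)` describes `loc t` only over `ℚ_{∞,𝔭}`, i.e. after restriction to `Gal(ℚ̄/ℚ_∞) ∩ D_v`. This file shows
that nothing is lost: the restriction from `Γ_N ∩ D_v` to `Gal(ℚ̄/ℚ_∞) ∩ D_v` on `H¹(·, E[2^∞])` is injective, because its
inflation kernel lives on the `2^∞`-torsion of `E` rational over the local tower `ℚ_{2,∞}·ℚ_v`, which is ZERO at a good supersingular `2`
(`SSFlatEC.eq_zero_of_mem_localTowerPointsOfEmb_of_two_nsmul`; Kobayashi Prop. 8.7 / Sprung Lemma 2.3 at `p = 2`), fed into the tree's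
inflation–restriction with trivial fixed part (`X11b.AcSelmer.resOfLe_injective_of_fixedPoints`). The odd-`p` GLOBAL analogue is
`Rank1Residual.Additive.resOfLe_towerTopSubgroup_injective_of_goodSupersingular` (which excludes `p = 2`).

## What is proved
* `pointsMapOfEmb_mem_localTowerPointsOfEmb_of_forall_smul` — a `ℚ̄`-point fixed by `Gal(ℚ̄/K_∞) ∩ D_v` maps into `E(K_∞·K_v)` (any `K`, `p`).
* `eq_zero_of_mem_localTowerPointsOfEmb_of_pow_nsmul_two` — `2^k · P = 0`, `P ∈ E(ℚ_{2,∞}·ℚ_v)` ⇒ `P = 0` (`GoodSS W 2`).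
* `resOfLe_kerSubgroup_inf_decomp_injective_two` — injectivity of `res : H¹(H ∩ D_v, E[2^∞]) → H¹(Gal(ℚ̄/ℚ_∞) ∩ D_v, E[2^∞])` for
  `Gal(ℚ̄/ℚ_∞) ≤ H`; `resOfLe_layerSubgroup_inf_decomp_injective_two` — the case `H = Γ_N`.

References: [Kobayashi2003] Prop. 8.7 (p. 16), Lemma 9.1 (p. 25); [Sprung2012] Lemma 2.3 (p. 1487); [GreenbergLNM1716] §3 Lemma 3.1 (p. 86);
[SerreGaloisCohomology1997] I §2.6 (b).
-/

set_option autoImplicit false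
-- the Theorems namespace of this sub repeats the summit name by design (D-0017 nested layout)
set_option linter.dupNamespace false

noncomputable section

open scoped Classical

namespace Summit.BirchSwinnertonDyer.BirchSwinnertonDyer.Theorems

namespace SignedKatoOffTwo.LocalTowerRes

open NumberField IsDedekindDomain Field WeierstrassCurve
  Literature.NumberTheory.EllipticCurves Literature.NumberTheory.EllipticCurves.Kobayashi2003
  Literature.NumberTheory.EllipticCurves.GreenbergSelmer
  Literature.NumberTheory.EllipticCurves.Sprung2012 Literature.NumberTheory.GaloisRepresentations ZpExtension
  Summit.BirchSwinnertonDyer.Rank1Residual.X11b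

universe u

section General

variable {K : Type u} [Field K] [NumberField K] (W : WeierstrassCurve K) {p : ℕ} [Fact p.Prime] (κ : ZpExtension K p)

/-- **A `K̄`-point fixed by `Gal(K̄/K_∞) ∩ D_v` lies in `E(K_∞·K_v)`** (for the chosen embedding `K̄ → K̄_v`: `D_v` is the image of
`Γ_{K_v}` and `ι_*` is equivariant). [cite: Kobayashi2003, Def. 1.1] [cite: GreenbergLNM1716, §2] -/
theorem pointsMapOfEmb_mem_localTowerPointsOfEmb_of_forall_smul (v : HeightOneSpectrum (𝓞 K)) (m : W.geomPoints)
    (hm : ∀ x ∈ κ.kerSubgroup ⊓ decomp v, x • m = m) :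
    pointsMapOfEmb W (closureEmb (K := K) (v.adicCompletion K)) m ∈
      localTowerPointsOfEmb κ (closureEmb (K := K) (v.adicCompletion K)) W := by
  rw [mem_localTowerPointsOfEmb_iff]
  intro τ hτ
  rw [← pointsMapOfEmb_smul]
  congr 1
  exact hm _ (Subgroup.mem_inf.2 ⟨(mem_localSubgroupOfEmb_iff _ _ τ).1 hτ, ⟨τ, rfl⟩⟩)

end General

section Two

variable (W : WeierstrassCurve ℚ) [W.IsElliptic] [W.IsGloballyMinimal]

/-- **No `2`-power torsion over the local tower at a good supersingular `2`**: `2^k · P = 0` and `P ∈ E(ℚ_{2,∞}·ℚ_v)` force `P = 0`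
(iterate `SSFlatEC.eq_zero_of_mem_localTowerPointsOfEmb_of_two_nsmul`). [cite: Kobayashi2003, Prop. 8.7 (p. 16)] [cite: Sprung2012, Lemma 2.3 (p. 1487)] -/
theorem eq_zero_of_mem_localTowerPointsOfEmb_of_pow_nsmul_two (hss : Rank1Residual.GoodSS W 2) (κ : ZpExtension ℚ 2)
    {v : HeightOneSpectrum (𝓞 ℚ)} (hv : (2 : 𝓞 ℚ) ∈ v.asIdeal)
    (ι : AlgebraicClosure ℚ →ₐ[ℚ] AlgebraicClosure (v.adicCompletion ℚ)) (k : ℕ)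
    {P : localPoints W (v.adicCompletion ℚ)} (hP : P ∈ localTowerPointsOfEmb κ ι W) (hk : 2 ^ k • P = 0) : P = 0 := by
  induction k generalizing P with
  | zero => simpa using hk
  | succ k ih =>
    have h2 : 2 • (2 ^ k • P) = 0 := by rw [← mul_nsmul', ← pow_succ', hk]
    exact ih hP (SSFlatEC.eq_zero_of_mem_localTowerPointsOfEmb_of_two_nsmul W hss κ hv ι
      ((localTowerPointsOfEmb κ ι W).nsmul_mem hP _) h2)

/-- **Local inflation–restriction at `p = 2` is injective along the tower**: for `W/ℚ` globally minimal with `GoodSS W 2`, `v ∋ 2` and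
every subgroup `H ⊇ Gal(ℚ̄/ℚ_∞)` (e.g. a layer `Γ_N`), the restriction `H¹(H ∩ D_v, E[2^∞]) → H¹(Gal(ℚ̄/ℚ_∞) ∩ D_v, E[2^∞])` is injective —
its inflation kernel is carried by the `2^∞`-torsion of `E` over `ℚ_{2,∞}·ℚ_v`, which vanishes. So a layer-`N` local class at `𝔭` is
determined by its restriction over `ℚ_{∞,𝔭}` (the currency of the Kummer witnesses in (PT-orth)). [cite: Kobayashi2003, Prop. 8.7 (p. 16), Lemma 9.1 (p. 25)]
[cite: GreenbergLNM1716, §3 Lemma 3.1 (p. 86)] [cite: SerreGaloisCohomology1997, I §2.6 (b)] -/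
theorem resOfLe_kerSubgroup_inf_decomp_injective_two (hss : Rank1Residual.GoodSS W 2) (κ : ZpExtension ℚ 2)
    (v : HeightOneSpectrum (𝓞 ℚ)) (hv : (2 : 𝓞 ℚ) ∈ v.asIdeal) {H : Subgroup (absoluteGaloisGroup ℚ)} (hH : κ.kerSubgroup ≤ H) :
    Function.Injective
      (resOfLe (W.geomPrimaryTorsion 2) (inf_le_inf_right (decomp v) hH : κ.kerSubgroup ⊓ decomp v ≤ H ⊓ decomp v)) := by
  haveI : ((κ.kerSubgroup).subgroupOf H).Normal := inferInstance
  haveI hN : ((κ.kerSubgroup ⊓ decomp v).subgroupOf (H ⊓ decomp v)).Normal :=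
    Subgroup.inf_subgroupOf_inf_normal_of_left (decomp v)
  refine AcSelmer.resOfLe_injective_of_fixedPoints _ hN (W.continuous_smul_geomPrimaryTorsion 2) fun m hm ↦ ?_
  obtain ⟨k, hk⟩ := (AddCommGroup.mem_primaryComponent).1 m.2
  have hP := pointsMapOfEmb_mem_localTowerPointsOfEmb_of_forall_smul W κ v (m : W.geomPoints) fun x hx ↦ by
    rw [← primaryComponent.coe_smul, hm x hx]
  have h0 : pointsMapOfEmb W (closureEmb (K := ℚ) (v.adicCompletion ℚ)) (m : W.geomPoints) = 0 :=
    eq_zero_of_mem_localTowerPointsOfEmb_of_pow_nsmul_two W hss κ hv _ k hP (by rw [← map_nsmul, hk, map_zero])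
  have hm0 : (m : W.geomPoints) = 0 :=
    pointsMapOfEmb_injective W (closureEmb (K := ℚ) (v.adicCompletion ℚ)) (by rw [h0, map_zero])
  exact Subtype.ext hm0

/-- **The layer case**: `res : H¹(Γ_N ∩ D_v, E[2^∞]) → H¹(Gal(ℚ̄/ℚ_∞) ∩ D_v, E[2^∞])` is injective for every layer `Γ_N = κ⁻¹(2^N ℤ₂)`.
[cite: Kobayashi2003, Lemma 9.1 (p. 25)] [cite: GreenbergLNM1716, §3 Lemma 3.1 (p. 86)] -/
theorem resOfLe_layerSubgroup_inf_decomp_injective_two (hss : Rank1Residual.GoodSS W 2) (κ : ZpExtension ℚ 2)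
    (v : HeightOneSpectrum (𝓞 ℚ)) (hv : (2 : 𝓞 ℚ) ∈ v.asIdeal) (N : ℕ) :
    Function.Injective
      (resOfLe (W.geomPrimaryTorsion 2)
        (inf_le_inf_right (decomp v) (κ.kerSubgroup_le_layerSubgroup N) :
          κ.kerSubgroup ⊓ decomp v ≤ κ.layerSubgroup N ⊓ decomp v)) :=
  resOfLe_kerSubgroup_inf_decomp_injective_two W hss κ v hv (κ.kerSubgroup_le_layerSubgroup N)

end Two

end SignedKatoOffTwo.LocalTowerRes

end Summit.BirchSwinnertonDyer.BirchSwinnertonDyer.Theorems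

end
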